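import Literature.AlgebraicGeometry.Resolution.RegularLocalRingsQuotient
import Literature.AlgebraicGeometry.Resolution.RegularLocalRingsNormal
import Mathlib.RingTheory.DiscreteValuationRing.TFAE
import Mathlib.RingTheory.Localization.AtPrime.Basic
import Mathlib.Algebra.CharP.Algebra
import HarnessLib

/-!
# Families of regular parameters: primality, independence, and the DVR of a parameter

Topic: `Literature/AlgebraicGeometry/Resolution`. Elementary consequences, in a regular local
ring `(O, 𝔪)`, of a family `x : ι → O` being **part of a regular system of parameters**, taken
in the cotangent form "no non-trivial `O`-linear combination of the `x_i` lies in `𝔪²`":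

  `hli : ∀ α, ∑ α_i x_i ∈ 𝔪² → ∀ i, α_i ∈ 𝔪`

(Matsumura, *Commutative Ring Theory*, Thm. 14.2: the images of the `x_i` in `𝔪/𝔪²` are
linearly independent over the residue field). This is the shape in which the simple normal
crossings hypothesis on a boundary `E` (`HasSNC`, `MarkedIdeals.lean`) is consumed by the
endgame of the crux `PicoverLocalModel` (line `giraud-cossart-normal-form`): the local
equations `x_j` of the boundary components through a point.

* `sub_sum_notMem_sq` — `x_j - ∑_{i ≠ j} β_i x_i ∉ 𝔪²`; `notMem_sq` — `x_j ∉ 𝔪²`;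
  `notMem_sq_sup_span_singleton` — `x_{j'} ∉ 𝔪² + (x_j)` (`j' ≠ j`);
  `notMem_span_pair` — `x_{j''} ∉ (x_j, x_{j'})` for a third index;
* `prime_apply` — each `x_j` is a prime element (Matsumura 14.2–14.3); `isPrime_span_singleton`;
* `isRegularLocalRing_quotient_span_singleton` (14.2), and in `O/(x_j)`: `prime_mk_apply` —
  the image of `x_{j'}` is prime, `not_dvd_mk_apply` — it does not divide the image of a third
  `x_{j''}`;
* `isDiscreteValuationRing_localization_span_singleton` — `O_{(x_j)}` is a discrete valuation
  ring with uniformizer `x_j` (`irreducible_algebraMap_localization`), of characteristic `p`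
  when `O` is (`charP_localization_span_singleton`).

Sources: [Matsumura1987] H. Matsumura, *Commutative Ring Theory*, CUP (1987), Thm. 14.2,
Thm. 14.3, Thm. 11.2 (local Noetherian domain of dimension one with principal maximal ideal is
a DVR). All statements PROVED from the tree's regular-local-ring toolkit
(`RegularLocalRingsQuotient.lean`, `RegularLocalRingsNormal.lean`) and Mathlib.
-/

noncomputable section

namespace Literature.AlgebraicGeometry.Resolution

open IsLocalRing

namespace RegularParameters

section Local

variable {O : Type*} [CommRing O] [IsLocalRing O] {ι : Type*} [Fintype ι] [DecidableEq ι]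
variable {x : ι → O}

/-- **Independence modulo `𝔪²`, affine form**: if no non-trivial combination of the `x_i` lies
in `𝔪²`, then `x_j - ∑ β_i x_i ∉ 𝔪²` whenever `β_j = 0`. [cite: Matsumura1987, Thm. 14.2] -/
theorem sub_sum_notMem_sq
    (hli : ∀ α : ι → O, ∑ i, α i * x i ∈ maximalIdeal O ^ 2 → ∀ i, α i ∈ maximalIdeal O)
    (j : ι) (β : ι → O) (hβ : β j = 0) :
    x j - ∑ i, β i * x i ∉ maximalIdeal O ^ 2 := by
  intro hmem
  have hsum : ∑ i, (Pi.single j (1 : O) - β : ι → O) i * x i = x j - ∑ i, β i * x i := by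
    simp only [Pi.sub_apply, sub_mul, Finset.sum_sub_distrib]
    congr 1
    rw [Finset.sum_eq_single j (fun i _ hij => by simp [Pi.single_eq_of_ne hij]) (by simp)]
    simp
  have h1 := hli (Pi.single j 1 - β) (hsum ▸ hmem) j
  simp only [Pi.sub_apply, Pi.single_eq_same, hβ, sub_zero] at h1
  exact (maximalIdeal.isMaximal O).ne_top (Ideal.eq_top_of_isUnit_mem _ h1 isUnit_one)

/-- Each member of an independent family lies outside `𝔪²`. [cite: Matsumura1987, Thm. 14.2] -/
theorem notMem_sq
    (hli : ∀ α : ι → O, ∑ i, α i * x i ∈ maximalIdeal O ^ 2 → ∀ i, α i ∈ maximalIdeal O)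
    (j : ι) : x j ∉ maximalIdeal O ^ 2 := by
  simpa using sub_sum_notMem_sq hli j 0 rfl

/-- `x_{j'} ∉ 𝔪² + (x_j)` for `j' ≠ j`. [cite: Matsumura1987, Thm. 14.2] -/
theorem notMem_sq_sup_span_singleton
    (hli : ∀ α : ι → O, ∑ i, α i * x i ∈ maximalIdeal O ^ 2 → ∀ i, α i ∈ maximalIdeal O)
    {j j' : ι} (hj : j' ≠ j) : x j' ∉ maximalIdeal O ^ 2 ⊔ Ideal.span {x j} := by
  intro hmem
  obtain ⟨m, hm, y, hy, hxy⟩ := Submodule.mem_sup.mp hmem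
  obtain ⟨b, rfl⟩ := Ideal.mem_span_singleton'.mp hy
  apply sub_sum_notMem_sq hli j' (Pi.single j b) (by simp [hj])
  have : ∑ i, Pi.single (M := fun _ => O) j b i * x i = b * x j := by
    rw [Finset.sum_eq_single j (fun i _ hij => by simp [Pi.single_eq_of_ne hij]) (by simp)]
    simp
  rw [this, ← hxy, add_sub_cancel_right]
  exact hm

/-- `x_{j''} ∉ (x_j, x_{j'})` for an index `j''` different from `j` and `j'`.
[cite: Matsumura1987, Thm. 14.2] -/
theorem notMem_span_pair
    (hli : ∀ α : ι → O, ∑ i, α i * x i ∈ maximalIdeal O ^ 2 → ∀ i, α i ∈ maximalIdeal O)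
    {j j' j'' : ι} (h1 : j'' ≠ j) (h2 : j'' ≠ j') :
    x j'' ∉ Ideal.span {x j, x j'} := by
  intro hmem
  obtain ⟨b, b', hbb⟩ := Ideal.mem_span_pair.mp hmem
  apply sub_sum_notMem_sq hli j'' (Pi.single j b + Pi.single j' b') (by simp [h1, h2])
  have : ∑ i, (Pi.single j b + Pi.single j' b' : ι → O) i * x i = b * x j + b' * x j' := by
    simp only [Pi.add_apply, add_mul, Finset.sum_add_distrib]
    rw [Finset.sum_eq_single j (fun i _ hij => by simp [Pi.single_eq_of_ne hij]) (by simp),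
      Finset.sum_eq_single j' (fun i _ hij => by simp [Pi.single_eq_of_ne hij]) (by simp)]
    simp
  rw [this, hbb, sub_self]
  exact Ideal.zero_mem _

end Local

section Regular

variable {O : Type*} [CommRing O] [IsRegularLocalRing O] {ι : Type*} [Fintype ι] [DecidableEq ι]
variable {x : ι → O}

/-- **Each member of a family of regular parameters is a prime element** (Matsumura 14.2 with
14.3: `O/(x_j)` is regular, hence a domain). [cite: Matsumura1987, Thm. 14.3] -/
theorem prime_apply (hx : ∀ j, x j ∈ maximalIdeal O)
    (hli : ∀ α : ι → O, ∑ i, α i * x i ∈ maximalIdeal O ^ 2 → ∀ i, α i ∈ maximalIdeal O)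
    (j : ι) : Prime (x j) :=
  IsRegularLocalRing.prime_of_not_mem_sq (hx j) (notMem_sq hli j)

/-- The ideal `(x_j)` is prime. [cite: Matsumura1987, Thm. 14.3] -/
theorem isPrime_span_singleton (hx : ∀ j, x j ∈ maximalIdeal O)
    (hli : ∀ α : ι → O, ∑ i, α i * x i ∈ maximalIdeal O ^ 2 → ∀ i, α i ∈ maximalIdeal O)
    (j : ι) : (Ideal.span {x j}).IsPrime :=
  (Ideal.span_singleton_prime (prime_apply hx hli j).ne_zero).mpr (prime_apply hx hli j)

/-- **`O/(x_j)` is a regular local ring** with `dim O/(x_j) + 1 = dim O`.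
[cite: Matsumura1987, Thm. 14.2] -/
theorem isRegularLocalRing_quotient_span_singleton (hx : ∀ j, x j ∈ maximalIdeal O)
    (hli : ∀ α : ι → O, ∑ i, α i * x i ∈ maximalIdeal O ^ 2 → ∀ i, α i ∈ maximalIdeal O)
    (j : ι) : IsRegularLocalRing (O ⧸ Ideal.span {x j}) ∧
      ringKrullDim (O ⧸ Ideal.span {x j}) + 1 = ringKrullDim O :=
  IsRegularLocalRing.quotient_span_singleton (hx j) (notMem_sq hli j)

/-- In `O/(x_j)` the image of another parameter `x_{j'}` is a prime element (it lies in
`𝔪̄ ∖ 𝔪̄²` of the regular local ring `O/(x_j)`). [cite: Matsumura1987, Thm. 14.3] -/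
theorem prime_mk_apply (hx : ∀ j, x j ∈ maximalIdeal O)
    (hli : ∀ α : ι → O, ∑ i, α i * x i ∈ maximalIdeal O ^ 2 → ∀ i, α i ∈ maximalIdeal O)
    {j j' : ι} (hj : j' ≠ j) : Prime (Ideal.Quotient.mk (Ideal.span {x j}) (x j')) := by
  haveI := (isRegularLocalRing_quotient_span_singleton hx hli j).1
  haveI : Nontrivial (O ⧸ Ideal.span {x j}) := inferInstance
  have hmax : maximalIdeal (O ⧸ Ideal.span {x j}) =
      (maximalIdeal O).map (Ideal.Quotient.mk _) := maximalIdeal_quotient_eq_map _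
  refine IsRegularLocalRing.prime_of_not_mem_sq ?_ ?_
  · rw [hmax]
    exact Ideal.mem_map_of_mem _ (hx j')
  · rw [hmax, ← Ideal.map_pow, Ideal.mem_quotient_iff_mem_sup]
    exact notMem_sq_sup_span_singleton hli hj

/-- In `O/(x_j)` the image of `x_{j'}` does not divide the image of a third parameter `x_{j''}`.
[cite: Matsumura1987, Thm. 14.2] -/
theorem not_dvd_mk_apply
    (hli : ∀ α : ι → O, ∑ i, α i * x i ∈ maximalIdeal O ^ 2 → ∀ i, α i ∈ maximalIdeal O)
    {j j' j'' : ι} (h1 : j'' ≠ j) (h2 : j'' ≠ j') :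
    ¬ Ideal.Quotient.mk (Ideal.span {x j}) (x j') ∣ Ideal.Quotient.mk (Ideal.span {x j}) (x j'') := by
  rintro ⟨c, hc⟩
  obtain ⟨c₀, rfl⟩ := Ideal.Quotient.mk_surjective c
  rw [← map_mul, Ideal.Quotient.eq, Ideal.mem_span_singleton'] at hc
  obtain ⟨b, hb⟩ := hc
  apply notMem_span_pair hli h1 h2
  exact Ideal.mem_span_pair.mpr ⟨b, c₀, by linear_combination hb⟩

omit [DecidableEq ι] [Fintype ι] in
/-- **The local ring of a parameter divisor is a discrete valuation ring**: for `y ∈ 𝔪 ∖ 𝔪²`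
in a regular local ring, the localisation `O_{(y)}` is a domain and a DVR (Noetherian local
domain, not a field, with principal maximal ideal `(y)`), with uniformizer the image of `y`.
[cite: Matsumura1987, Thm. 11.2] -/
theorem isDiscreteValuationRing_localization {y : O} (hy : y ∈ maximalIdeal O)
    (hy2 : y ∉ maximalIdeal O ^ 2) (L : Type*) [CommRing L] [Algebra O L]
    [(Ideal.span {y}).IsPrime] [IsLocalization.AtPrime L (Ideal.span {y})] :
    ∃ (_ : IsDomain L), IsDiscreteValuationRing L ∧ Irreducible (algebraMap O L y) := by
  haveI := isDomain_of_isRegularLocalRing O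
  have hprime : Prime y := IsRegularLocalRing.prime_of_not_mem_sq hy hy2
  have hle : (Ideal.span {y}).primeCompl ≤ nonZeroDivisors O :=
    le_nonZeroDivisors_of_noZeroDivisors fun h => Ideal.mem_primeCompl_iff.mp h (Ideal.zero_mem _)
  haveI : IsDomain L := IsLocalization.isDomain_of_le_nonZeroDivisors L hle
  haveI : IsLocalRing L := IsLocalization.AtPrime.isLocalRing L (Ideal.span {y})
  haveI : IsNoetherianRing L := IsLocalization.isNoetherianRing (Ideal.span {y}).primeCompl L
    inferInstance
  have hmax : maximalIdeal L = Ideal.span {algebraMap O L y} := by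
    rw [← IsLocalization.AtPrime.map_eq_maximalIdeal (Ideal.span {y}) L, Ideal.map_span,
      Set.image_singleton]
  have hy0 : algebraMap O L y ≠ 0 := fun h =>
    hprime.ne_zero ((injective_iff_map_eq_zero _).mp (IsLocalization.injective L hle) y h)
  have hnf : ¬ IsField L := by
    intro hF
    have := (IsLocalRing.isField_iff_maximalIdeal_eq).mp hF
    rw [hmax, Ideal.span_singleton_eq_bot] at this
    exact hy0 this
  have hprinc : (maximalIdeal L).IsPrincipal := ⟨⟨algebraMap O L y, hmax⟩⟩
  have hdvr : IsDiscreteValuationRing L := ((IsDiscreteValuationRing.TFAE L hnf).out 0 4).mpr hprinc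
  exact ⟨inferInstance, hdvr,
    IsDiscreteValuationRing.irreducible_of_span_eq_maximalIdeal _ hy0 hmax⟩

omit [DecidableEq ι] [Fintype ι] [IsRegularLocalRing O] in
/-- A localisation of a ring of characteristic `p` at a prime has characteristic `p` (the
localisation map of a domain is injective). [folklore] -/
theorem charP_localization [IsDomain O] (p : ℕ) [CharP O p] (𝔮 : Ideal O) [𝔮.IsPrime]
    (L : Type*) [CommRing L] [Algebra O L] [IsLocalization.AtPrime L 𝔮] : CharP L p :=
  charP_of_injective_algebraMap (IsLocalization.injective L
    (le_nonZeroDivisors_of_noZeroDivisors fun h =>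
      Ideal.mem_primeCompl_iff.mp h (Ideal.zero_mem 𝔮))) p

end Regular

end RegularParameters

end Literature.AlgebraicGeometry.Resolution

end
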